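/- Copyright: the b2b-balaban cell (near-miss cell 7), T⁴-continuum fan-out; row NE7b OWNER lineage `t4-ne7b-p1`
(gen 60) — «(d2′) ON THE COUNT SIDE: THE CHAIN CLOCK IS BOOKED», part 2 of 2 (kernel item of RULING R-OWNER-60-1).
Released under the licence of the surrounding project. -/
import Summits.QuantumFields.BalabanUV.T4Continuum.Support.HistoryRealise
import Summits.QuantumFields.BalabanUV.T4Continuum.Support.HistoryReadinessChainWindows

/-!
# Realised histories ON PRINT's CHAIN CLOCK (`StopAtC`) stop strictly inside the booked windows `dictW` — the rider
(d2′) «the printed chain's (N+1)-th scale» is census-neutral for the COUNT, with the SAME letters (row NE7b,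
R-OWNER-60-1, part 2 of 2; part 1 = `HistoryReadinessChainWindows`)

Summits-side support leaf of the T⁴-continuum cell (rung (B)+1 on a FINITE torus only; NOT infinite volume, NOT the
mass gap, NOT the Clay statement; NOT a proof of the spine estimate NE7b — the cell's OWN estimate, NOT PRINTED, NOT
PROVED).  [folklore] finite combinatorics in the ℤᵈ INDEX MODEL over row S1b's geometric layer (`HistoryWindows`,
`HistoryRealise`), the owner's g59 companion `HistoryReadinessChainScale` (`StopAtC`) and part 1; no `[cite:]` tag, no
`Prop` fact of Bałaban's minted (the three `def`s are PREDICATES with parameters — hypothesis shapes, row S1b's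
`Stops`∕`PendingAt`∕`Realises` re-clocked), zero `sorry`.  B15 = [Balaban1989LargeFieldI] p. 179 and B16 =
[Balaban1989LargeFieldII] pp. 384–387 are manuscripts UNDER AUDIT and appear only as LOCATORS.

WHY (R-OWNER-59-1, rider (d2′); part 1's header).  The COUNT's lifetime budget `dictW` is certified for the TREE clock by
`HistoryRealise.exists_stop_lt_reach` (every realised history stops STRICTLY inside its booked life; `L ≥ 4`, `R ≥ 1`,
`n₁ ≥ 13`).  THIS FILE re-clocks row S1b's realisation predicate on print's CHAIN clock — a RENEWAL at the FIRST
CHAIN-readiness, join partners CHAIN-pending through the join scale — and proves the same conclusion with the same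
letters: `dictW`, `L ≥ 4`, `R ≥ 1`, `n₁ ≥ 13` UNTOUCHED (`exists_stopC_lt_reach`).  Birth and join are part 1's bounds;
RENEWAL: a chain-stop carries two consecutive (i)-scales, so condition (i) holds at EVERY later scale of the line
(`condI_orbit_of_stopsC`), in particular AT THE RENEWAL SCALE — print's sentence [B16] p. 386 l. 3–4 «because Z is a
small domain, it is contained in a cube of the size 100MR_{j+1}, hence K = R_{j+1} for Z» is a THEOREM of the model on
the chain clock (`condI_of_realisesC_renew`; on the tree clock with `R = 1` the model does not give it: one (i)-scale
followed by a no-gain step can leave `119 > 100` cubes per side) — and the renewed line chain-stops at EXACTLY `R_{h+1}`.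

WHAT.  §1 `StopsC`, `PendingAtC`, `RealisesC`; `StopsC.stops`∕`.pos`∕`.subset`, `pendingAtC_of_pendingAt`,
`condI_orbit_of_stopsC`, **`stopsC_renew`** (the renewal step, history-free).  §2 **`exists_stopC_lt_reach`** (MAIN).  §3 the displays re-derived on the chain clock:
`lt_reach_of_pendingAtC`, `renew_lt_reach_C`, `joinInLife_of_realisesC`, **`condI_of_realisesC_renew`**,
`adm_of_realisesC`.  §4 sanity: `realisesC_unit` and a numeric instance of the main theorem's letters.

HONEST SCOPE.  Index-model combinatorics on hypothesis shapes; the cell's process of record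
(`HistoryGenealogyInstantiateM`, clock `StopsM`) is NOT edited and no carrier is twinned (a `StopAtC` process twin stays
a DESIGN NOTE under FREEZE (0)); what is certified is that the (ID) reading's schedule rider (d2′) costs NOTHING in the
COUNT's booked lifetimes on row S1b's clauses (`PendingAt` at joins).  The print-exact-pendency twin
(`HistoryRealisePrint.PendingBefore`, repair R-40-a) re-clocked the same way needs, in the one sub-case «both partners
chain-ready EXACTLY at the join scale», a 13-step two-box contraction lemma that `B16MergeHorizon.condI_union`'s generic
constant `14` does not supply — NOT claimed here.  Census NONE; R∕T rows by count UNCHANGED.  NE7b NOT PRINTED ∕ NOT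
PROVED; spine 0∕9.  HONEST DEPENDENCY (cell): continuum YM on T⁴ ⇐ BetaPertH ∧ nine spine estimates (0/9 proved);
BetaPertH ⇐ (D1) ∧ (D4) ∧ CAP+tail; G-an2-4 gates asym, D1 and NE2/3/4.  This file changes none of it.
-/

open Finset
open Literature.MathematicalPhysics.QuantumFieldTheory.Balaban1983to89
open Literature.MathematicalPhysics.QuantumFieldTheory.Balaban1983to89.B13ScaleTransfer
open Literature.MathematicalPhysics.QuantumFieldTheory.Balaban1983to89.TreeLength
open Literature.MathematicalPhysics.QuantumFieldTheory.Balaban1983to89.B16SProfile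
open Literature.MathematicalPhysics.QuantumFieldTheory.Balaban1983to89.B16StoppingRule
open Literature.MathematicalPhysics.QuantumFieldTheory.Balaban1983to89.B16MergeGeometry
open Literature.MathematicalPhysics.QuantumFieldTheory.Balaban1983to89.B16MergeHorizon
open T4PersistenceDictionary
open Summit.QuantumFields.BalabanUV.T4Continuum.HistoryAdmissible
open Summit.QuantumFields.BalabanUV.T4Continuum.HistoryWindows
open Summit.QuantumFields.BalabanUV.T4Continuum.HistoryRealise
open Summit.QuantumFields.BalabanUV.T4Continuum.HistoryReadinessChainScale
open Summit.QuantumFields.BalabanUV.T4Continuum.HistoryReadinessChainWindows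

namespace Summit.QuantumFields.BalabanUV.T4Continuum.HistoryReadinessChainRealise

noncomputable section

variable {d : ℕ}

/-! ## §1 Realised histories on the chain clock -/

/-- **`StopsC L s R t₀ Z k`**: the orbit of the domain `Z` formed at `t₀` has the CHAIN stopping property (`StopAtC`:
the tree's conditions (i), (ii) with memory `N = R t₀`, the steps after `t₀` clean, AND condition (i) at the chain's
bottom scale `k − R t₀`) at the relative index `k`. [folklore] -/
def StopsC (L : ℕ) (s : ℕ → ℕ) (R : ℕ → ℕ) (t₀ : ℕ) (Z : Finset (Pt d)) (k : ℕ) : Prop :=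
  StopAtC 100 (R t₀) (fun _ => True) (orbit L s t₀ Z) k

/-- a chain-stop is a tree-stop («tree ready first») [folklore] -/
theorem StopsC.stops {L : ℕ} {s R : ℕ → ℕ} {t₀ : ℕ} {Z : Finset (Pt d)} {k : ℕ} (h : StopsC L s R t₀ Z k) :
    Stops L s R t₀ Z k :=
  h.1

/-- a chain-stop has a positive index [folklore] -/
theorem StopsC.pos {L : ℕ} {s R : ℕ → ℕ} {t₀ : ℕ} {Z : Finset (Pt d)} {k : ℕ} (h : StopsC L s R t₀ Z k) : 0 < k :=
  h.1.1

/-- the chain stopping property passes to sub-domains (their orbits are smaller) [folklore] -/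
theorem StopsC.subset {L : ℕ} {s R : ℕ → ℕ} {t₀ : ℕ} {Z Z' : Finset (Pt d)} (hZ : Z' ⊆ Z) {k : ℕ}
    (h : StopsC L s R t₀ Z k) : StopsC L s R t₀ Z' k :=
  ⟨Stops.subset hZ h.1, condI_subset (orbit_mono L s t₀ hZ _) h.2⟩

/-- **`PendingAtC L s R t₀ Z K`**: the domain formed at `t₀ ≤ K` is still pending at the cutoff `K` ON THE CHAIN CLOCK —
its orbit has not CHAIN-stopped at any index up to `K − t₀`. [folklore] -/
def PendingAtC (L : ℕ) (s : ℕ → ℕ) (R : ℕ → ℕ) (t₀ : ℕ) (Z : Finset (Pt d)) (K : ℕ) : Prop :=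
  t₀ ≤ K ∧ ∀ k, k ≤ K - t₀ → ¬ StopsC L s R t₀ Z k

/-- tree-clock pendency implies chain-clock pendency (fewer indices are chain-stops). [folklore] -/
theorem pendingAtC_of_pendingAt {L : ℕ} {s R : ℕ → ℕ} {t₀ : ℕ} {Z : Finset (Pt d)} {K : ℕ}
    (h : PendingAt L s R t₀ Z K) : PendingAtC L s R t₀ Z K :=
  ⟨h.1, fun k hk hS => h.2 k hk hS.stops⟩

/-- **REALISED HISTORIES ON THE CHAIN CLOCK** — row S1b's `Realises` with every readiness read by `StopsC`: a NEW REGION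
(anchor ∈ region, face-connected, class `≥ treeLen`); a RENEWAL at `h + 1` of a line whose domain is CHAIN-ready AT `h`
for the first time (`StopsC` at `h − t`, not earlier; the new domain is the `S`-image at `h + 1`); a JOIN at `s` of two
lines both CHAIN-pending at `s` whose current images touch, the joined domain lying inside their union. [folklore] -/
def RealisesC (L : ℕ) (s : ℕ → ℕ) (R : ℕ → ℕ) : PGen (Pt d × Finset (Pt d)) → Finset (Pt d) → Prop
  | .birth _ cls zZ, Z => zZ.2 = Z ∧ zZ.1 ∈ Z ∧ FaceConnected Z ∧ treeLen Z ≤ cls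
  | .renew G h, Z => ∃ ZG, RealisesC L s R G ZG ∧ StopsC L s R G.lastStep ZG (h - G.lastStep) ∧
      (∀ k, k < h - G.lastStep → ¬ StopsC L s R G.lastStep ZG k) ∧ Z = orbit L s G.lastStep ZG (h + 1 - G.lastStep)
  | .join X Y sj, Z => ∃ ZX ZY, RealisesC L s R X ZX ∧ RealisesC L s R Y ZY ∧ X.lastStep ≤ sj ∧ Y.lastStep ≤ sj ∧
      PendingAtC L s R X.lastStep ZX sj ∧ PendingAtC L s R Y.lastStep ZY sj ∧
      (∃ a ∈ orbit L s X.lastStep ZX (sj - X.lastStep), ∃ c ∈ orbit L s Y.lastStep ZY (sj - Y.lastStep), Touch a c) ∧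
      Z ⊆ orbit L s X.lastStep ZX (sj - X.lastStep) ∪ orbit L s Y.lastStep ZY (sj - Y.lastStep)

section Main

variable {L : ℕ} {s R : ℕ → ℕ} (hL : 4 ≤ L) (hdrop : ∀ m, DropCtl s m) (hR : ∀ t, 1 ≤ R t) {n₁ : ℕ} (hn₁ : 13 ≤ n₁)
include hL hdrop hR

/-- a chain-stop at `k` of a line formed at `t` gives condition (i) of its orbit at EVERY index `≥ k − 1` (part 1 §1, on
the flow read from `t`; the drop control holds on every horizon). [folklore] -/
theorem condI_orbit_of_stopsC {t : ℕ} {Z : Finset (Pt d)} {k : ℕ} (h : StopsC L s R t Z k) :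
    ∀ l, k - 1 ≤ l → CondI 100 (orbit L s t Z l) := fun l hl =>
  condI_from_stopAtC (by omega) (dropCtl_from hdrop t l) (X := orbit L s t Z) (fun l => orbit_succ L s t Z l) (hR t)
    h l hl le_rfl

/-- **THE RENEWAL STEP ON THE CHAIN CLOCK, HISTORY-FREE** («hence K = R_{j+1} for Z», [B16] p. 386 l. 3–4 as
LOCATOR): if the line formed at `t` is chain-ready at `h` (`StopsC` at `h − t`), the RENEWED line — formed at `h + 1`,
domain = the old line's image at `h + 1` — chain-stops at EXACTLY `R_{h+1}`: by `condI_orbit_of_stopsC` condition (i)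
holds at every scale of the old orbit from `h − t − 1` on, in particular AT the renewal scale (the chain's bottom for
the new line) and at all later ones. [folklore] -/
theorem stopsC_renew {t h : ℕ} {ZG : Finset (Pt d)} (hready : StopsC L s R t ZG (h - t)) :
    StopsC L s R (h + 1) (orbit L s t ZG (h + 1 - t)) (R (h + 1)) := by
  have ht : t < h := by have := hready.pos; omega
  have hall := condI_orbit_of_stopsC hL hdrop hR hready
  have hsh : ∀ l, orbit L s (h + 1) (orbit L s t ZG (h + 1 - t)) l = orbit L s t ZG (h + 1 - t + l) := by
    intro l
    rw [orbit_add, show t + (h + 1 - t) = h + 1 by omega]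
  show StopAtC 100 (R (h + 1)) (fun _ => True) (orbit L s (h + 1) (orbit L s t ZG (h + 1 - t))) (R (h + 1))
  refine ⟨⟨hR (h + 1), ?_, le_rfl, fun l _ _ => ⟨trivial, ?_⟩⟩, ?_⟩
  · rw [hsh]; exact hall _ (by omega)
  · rw [hsh]; exact hall _ (by omega)
  · rw [hsh]; exact hall _ (by omega)

include hn₁

/-! ## §2 The main theorem -/

/-- **MAIN THEOREM — THE CHAIN CLOCK IS BOOKED.**  Every history realised ON THE CHAIN CLOCK chain-stops at some `k ≥ 1`
with `lastStep + k < toGen.reach (dictW R n₁)` — STRICTLY inside the booked life of its canonical label, with the SAME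
letters as the tree clock's `HistoryRealise.exists_stop_lt_reach` (`L ≥ 4`, drop control on every horizon, sizes
`R ≥ 1`, merger allowance `n₁ ≥ 13`; the window table `dictW` untouched).  Birth: `stopAtC_birth` + `birth_lt_dictW`;
renewal: `stopsC_renew` (two consecutive (i)-scales ⇒ (i) from the renewal scale on ⇒ chain-stop at exactly
`R_{h+1}`) + `restart_lt_dictW`; join: the induction hypotheses + `condI_orbit_of_stopsC` + `stopAtC_join` + `join_lt_dictW`. [folklore] -/
theorem exists_stopC_lt_reach :
    ∀ (P : PGen (Pt d × Finset (Pt d))) (Z : Finset (Pt d)), RealisesC L s R P Z →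
      ∃ k, 1 ≤ k ∧ StopsC L s R P.lastStep Z k ∧ P.lastStep + k < P.toGen.reach (dictW R n₁)
  | .birth j cls zZ, Z, hRZ => by
      obtain ⟨-, hz, hZc, hcls⟩ := hRZ
      obtain ⟨k, hk1, hk, hstop⟩ := stopAtC_birth (hR j) hL (dropCtl_from hdrop j (fatWait cls + R j)) ⟨_, hz⟩ hZc
        hcls (fun _ => True) (fun _ _ _ => trivial) le_rfl
      refine ⟨k, hk1, hstop, ?_⟩
      simp only [PGen.lastStep, PGen.toGen, Gen.reach_born, dictW_birth]
      omega
  | .renew G h, Z, hRZ => by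
      obtain ⟨ZG, -, hready, -, rfl⟩ := hRZ
      refine ⟨R (h + 1), hR (h + 1), stopsC_renew hL hdrop hR hready, ?_⟩
      have := hready.pos
      have h1 := restart_lt_dictW R n₁ (h + 1)
      simp only [PGen.lastStep, PGen.toGen, Gen.reach_renew]
      omega
  | .join X Y sj, Z, hRZ => by
      obtain ⟨ZX, ZY, hX, hY, htX, htY, hpX, hpY, ⟨a, ha, c, hc, hac⟩, hZ⟩ := hRZ
      obtain ⟨kX, hkX1, hsX, hrX⟩ := exists_stopC_lt_reach X ZX hX
      obtain ⟨kY, hkY1, hsY, hrY⟩ := exists_stopC_lt_reach Y ZY hY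
      set tX := X.lastStep
      set tY := Y.lastStep
      -- partners chain-pending at the join: their chain-stops lie after `sj`
      have hKX : sj - tX < kX := by
        by_contra hle; exact hpX.2 kX (by omega) hsX
      have hKY : sj - tY < kY := by
        by_contra hle; exact hpY.2 kY (by omega) hsY
      -- condition (i) of the partners from own index MINUS ONE on, in the coordinates of the join scale
      have hXI : ∀ m, tX + kX - sj - 1 ≤ m →
          CondI 100 (Siter (ratio L fun i => s (sj + i)) m (orbit L s tX ZX (sj - tX))) := by
        intro m hm
        have h := condI_orbit_of_stopsC hL hdrop hR hsX ((sj - tX) + m) (by omega)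
        rw [orbit_add, show tX + (sj - tX) = sj by omega] at h
        exact h
      have hYI : ∀ m, tY + kY - sj - 1 ≤ m →
          CondI 100 (Siter (ratio L fun i => s (sj + i)) m (orbit L s tY ZY (sj - tY))) := by
        intro m hm
        have h := condI_orbit_of_stopsC hL hdrop hR hsY ((sj - tY) + m) (by omega)
        rw [orbit_add, show tY + (sj - tY) = sj by omega] at h
        exact h
      obtain ⟨k, hk1, hkle, hstop⟩ := stopAtC_join (show 2 ≤ L by omega)
        (dropCtl_from hdrop sj (max (tX + kX - sj) (tY + kY - sj) + 13 + R sj)) ha hc hac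
        (K₁ := tX + kX - sj) (K₂ := tY + kY - sj) (by omega) (by omega)
        (fun m hm => hXI m (by omega)) (fun m hm => hYI m (by omega)) (N := R sj) (fun _ => True)
        (fun _ _ _ => trivial) le_rfl
      refine ⟨k, hk1, ?_, ?_⟩
      · apply StopsC.subset hZ
        show StopAtC 100 (R sj) (fun _ => True)
          (orbit L s sj (orbit L s tX ZX (sj - tX) ∪ orbit L s tY ZY (sj - tY))) k
        exact hstop
      · have h := join_lt_dictW R hn₁ sj (r₁ := X.toGen.reach (dictW R n₁)) (r₂ := Y.toGen.reach (dictW R n₁)) hkle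
          (by omega) (by omega)
        simp only [PGen.lastStep, PGen.toGen, Gen.reach_merge]
        exact h

/-! ## §3 The displays of row S1b, re-derived on the chain clock -/

/-- **CHAIN-PENDING AT THE CUTOFF ⇒ INSIDE THE BOOKED LIFE** (the socket field `pending`, on the chain clock): if the
last domain of a chain-clock history is still chain-pending at the cutoff `K`, then `K < toGen.reach (dictW R n₁)`.
[folklore] -/
theorem lt_reach_of_pendingAtC {P : PGen (Pt d × Finset (Pt d))} {Z : Finset (Pt d)} (hP : RealisesC L s R P Z)
    {K : ℕ} (hK : PendingAtC L s R P.lastStep Z K) : K < P.toGen.reach (dictW R n₁) := by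
  obtain ⟨k, -, hs, hlt⟩ := exists_stopC_lt_reach hL hdrop hR hn₁ P Z hP
  have : K - P.lastStep < k := by
    by_contra hle; exact hK.2 k (by omega) hs
  omega

/-- a renewal on the chain clock happens strictly inside the booked life of the renewed line [folklore] -/
theorem renew_lt_reach_C {G : PGen (Pt d × Finset (Pt d))} {h : ℕ} {Z : Finset (Pt d)}
    (hP : RealisesC L s R (.renew G h) Z) : h < G.toGen.reach (dictW R n₁) := by
  obtain ⟨ZG, hG, hready, hfirst, -⟩ := hP
  obtain ⟨k, -, hs, hlt⟩ := exists_stopC_lt_reach hL hdrop hR hn₁ G ZG hG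
  have : h - G.lastStep ≤ k := by
    by_contra hlt'; exact hfirst k (by omega) hs
  have := hready.pos
  omega

/-- **`JoinInLife` ON THE CHAIN CLOCK**: every join of a chain-clock history happens inside both partners' booked lives.
[folklore] -/
theorem joinInLife_of_realisesC :
    ∀ (P : PGen (Pt d × Finset (Pt d))) (Z : Finset (Pt d)), RealisesC L s R P Z → P.JoinInLife (dictW R n₁)
  | .birth _ _ _, _, _ => trivial
  | .renew G h, Z, hP => by
      obtain ⟨ZG, hG, -, -, -⟩ := hP
      exact joinInLife_of_realisesC G ZG hG
  | .join X Y sj, Z, hP => by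
      obtain ⟨ZX, ZY, hX, hY, -, -, hpX, hpY, -, -⟩ := hP
      exact ⟨joinInLife_of_realisesC X ZX hX, joinInLife_of_realisesC Y ZY hY,
        lt_reach_of_pendingAtC hL hdrop hR hn₁ hX hpX, lt_reach_of_pendingAtC hL hdrop hR hn₁ hY hpY⟩

omit hn₁ in
/-- **[B16] p. 386 l. 3–4 AS A THEOREM OF THE MODEL, ON THE CHAIN CLOCK**: the domain of a RENEWED line — the `S`-image,
at the renewal scale, of a domain chain-ready one scale earlier — satisfies condition (i) («because Z is a small domain,
it is contained in a cube of the size 100MR_{j+1}», LOCATOR only): the chain's two consecutive (i)-scales persist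
(§1).  (On the tree clock with memory `R = 1` the model does NOT give this: one (i)-scale followed by a no-gain step
can leave a domain of `119 > 100` cubes per side.) [folklore] -/
theorem condI_of_realisesC_renew {G : PGen (Pt d × Finset (Pt d))} {h : ℕ} {Z : Finset (Pt d)}
    (hP : RealisesC L s R (.renew G h) Z) : CondI 100 Z := by
  obtain ⟨ZG, -, hready, -, rfl⟩ := hP
  exact condI_orbit_of_stopsC hL hdrop hR hready _ (by omega)

end Main

/-- **`Adm` ON THE CHAIN CLOCK**: a chain-clock history observed by a cutoff `K ≥ lastStep` obeys print's timing
discipline (renewals after readiness, which is after the last event; joins after both partners' last events). [folklore] -/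
theorem adm_of_realisesC {L : ℕ} {s R : ℕ → ℕ} :
    ∀ (P : PGen (Pt d × Finset (Pt d))) (Z : Finset (Pt d)), RealisesC L s R P Z → ∀ {K : ℕ}, P.lastStep ≤ K → P.Adm K
  | .birth _ _ _, _, _, _, hK => hK
  | .renew G h, Z, hP, K, hK => by
      obtain ⟨ZG, hG, hready, -, -⟩ := hP
      have := hready.pos
      simp only [PGen.lastStep] at hK
      exact ⟨adm_of_realisesC G ZG hG (by omega), by omega, hK⟩
  | .join X Y sj, Z, hP, K, hK => by
      obtain ⟨ZX, ZY, hX, hY, htX, htY, -, -, -, -⟩ := hP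
      exact ⟨adm_of_realisesC X ZX hX (htX.trans hK), adm_of_realisesC Y ZY hY (htY.trans hK), htX, htY, hK⟩

/-! ## §4 Sanity -/

namespace Sanity

open B16MergeGeometry.OneDim

/-- the unit region of `HistoryRealise.Sanity` is realised on the chain clock too (births read no clock) [folklore] -/
theorem realisesC_unit (L : ℕ) (s R : ℕ → ℕ) : RealisesC L s R HistoryRealise.Sanity.unit {pt 0} :=
  ⟨rfl, mem_singleton_self _,
    fun x hx y hy => by rw [mem_singleton] at hx hy; subst hx; subst hy; exact Relation.ReflTransGen.refl,
    by rw [treeLen_singleton]; norm_num⟩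

/-- a numeric instance of the main theorem's letters: `L = 13`, constant exponents, `R ≡ 2`, `n₁ = 13` — the unit
region born at step `0` chain-stops strictly inside its booked life `fatWait 0 + 2 + 1 = 4`. [folklore] -/
example : ∃ k, 1 ≤ k ∧ StopsC 13 (fun _ => 0) (fun _ => 2) 0 ({pt 0} : Finset (Pt 1)) k ∧
    0 + k < (HistoryRealise.Sanity.unit).toGen.reach (dictW (fun _ => 2) 13) :=
  exists_stopC_lt_reach (by norm_num) (fun m i k _ _ => by simp) (fun _ => by norm_num) le_rfl
    HistoryRealise.Sanity.unit {pt 0} (realisesC_unit 13 _ _)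

end Sanity

/-! ## §5 Monotonicity of the chain clock (INTERFACE REQUEST NE7b IR-60-2, owner gen 60 → leaf-06)

On the CHAIN clock readiness PERSISTS: a chain-stop at `k` carries two consecutive (i)-scales `k − 1, k` (part 1 §1,
`HistoryReadinessChainWindows.condI_from_stopAtC`), so condition (i) holds at every later scale of the orbit, and the
window ∕ bottom scales of a later index `k′` are window ∕ bottom scales of `k` or lie past `k − 1`.  Hence the set of
chain-stop indices of a line is UP-CLOSED (`StopsC.of_le`), it is the interval from its least element on
(`stopsC_iff_le_of_first`, `stopsC_iff_find_le`), «chain-ready at `h` FOR THE FIRST TIME» in `RealisesC.renew` is the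
ONE-index test «ready at `h − t`, not at `h − t − 1`» (`firstStopsC_iff`), and chain-PENDENCY at a cutoff is the
ONE-index test «not chain-ready at the last index» (`pendingAtC_iff_not_stopsC_last`).  The TREE clock LACKS this in
the model (`StopAt` is not monotone: one (i)-scale followed by a no-gain step can leave `119 > 100` cubes per side,
`HistoryWindows.condI_from_add_two`).  Letters: `3 ≤ L` (weaker than the file's `4 ≤ L`), drop control on every
horizon, memory `1 ≤ R t₀` at the formation step only.  Route: leaf-06 g56's pre-registered `stopAtC_mono` ∕
`stopAtC_iff_le_of_first` (E-datum E-ne7bleaf06-g56-1), transported to orbits by `orbit_succ` + `dropCtl_from`.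
[folklore] index arithmetic on hypothesis shapes; nothing of Bałaban's asserted; census NONE. -/

section Monotone

variable {L : ℕ} (hL : 3 ≤ L) {s R : ℕ → ℕ} (hdrop : ∀ m, DropCtl s m) {t₀ : ℕ} (hR : 1 ≤ R t₀)
include hL hdrop hR

/-- **THE CHAIN CLOCK IS MONOTONE**: a line chain-ready at the relative index `k` is chain-ready at EVERY later index
`k′ ≥ k` (`L ≥ 3`, drop control on every horizon, memory `R t₀ ≥ 1`).  Condition (i) at `k′` and at the scales of
`k′`'s window from `k − 1` on come from the two consecutive (i)-scales of the chain-stop at `k`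
(`condI_from_stopAtC` on the orbit, horizon `k′`); the earlier window scales and the bottom scale `k′ − R t₀` are
window ∕ bottom scales of `k`. [folklore] -/
theorem StopsC.of_le {Z : Finset (Pt d)} {k k' : ℕ} (h : StopsC L s R t₀ Z k) (hkk' : k ≤ k') :
    StopsC L s R t₀ Z k' := by
  have hI : ∀ l, k - 1 ≤ l → l ≤ k' → CondI 100 (orbit L s t₀ Z l) :=
    condI_from_stopAtC hL (dropCtl_from hdrop t₀ k') (X := orbit L s t₀ Z) (fun l => orbit_succ L s t₀ Z l) hR h
  obtain ⟨⟨hk, -, hNk, hall⟩, hlow⟩ := h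
  refine ⟨⟨by omega, hI k' (by omega) le_rfl, by omega, fun l h1 h2 => ⟨trivial, ?_⟩⟩, ?_⟩
  · rcases Nat.lt_or_ge l (k - 1) with hl | hl
    · exact (hall l (by omega) (by omega)).2
    · exact hI l hl h2
  · rcases Nat.lt_or_ge (k' - R t₀) (k - 1) with hl | hl
    · rcases Nat.lt_or_ge (k - R t₀) (k' - R t₀) with h3 | h3
      · exact (hall (k' - R t₀) (by omega) (by omega)).2
      · have h4 : k' - R t₀ = k - R t₀ := by omega
        rw [h4]; exact hlow
    · exact hI (k' - R t₀) hl (by omega)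

/-- **UP-CLOSED FROM THE FIRST CHAIN-STOP**: if `k₀` is the least chain-stop index of a line, then the line is
chain-ready at `k` iff `k₀ ≤ k` — the chain-stop indices form the interval `[k₀, ∞)`. [folklore] -/
theorem stopsC_iff_le_of_first {Z : Finset (Pt d)} {k₀ : ℕ} (h0 : StopsC L s R t₀ Z k₀)
    (hmin : ∀ k, k < k₀ → ¬ StopsC L s R t₀ Z k) {k : ℕ} : StopsC L s R t₀ Z k ↔ k₀ ≤ k :=
  ⟨fun h => by by_contra hlt; exact hmin k (by omega) h, fun hle => h0.of_le hL hdrop hR hle⟩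

open Classical in
/-- the same with the least index spelled `Nat.find`: a line that chain-stops at all is chain-ready at `k` iff
`Nat.find _ ≤ k`. [folklore] -/
theorem stopsC_iff_find_le {Z : Finset (Pt d)} (hex : ∃ k, StopsC L s R t₀ Z k) {k : ℕ} :
    StopsC L s R t₀ Z k ↔ Nat.find hex ≤ k :=
  stopsC_iff_le_of_first hL hdrop hR (Nat.find_spec hex) (fun _ hk => Nat.find_min hex hk)

/-- **«READY FOR THE FIRST TIME» IS A ONE-INDEX TEST**: a line is chain-ready at `K` and at no earlier index iff it is
chain-ready at `K` and NOT at `K − 1` (for `K = 0` both sides fail: a chain-stop has a positive index) — the shape of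
the first-readiness clause of `RealisesC.renew` (`K = h − G.lastStep`). [folklore] -/
theorem firstStopsC_iff {Z : Finset (Pt d)} {K : ℕ} :
    (StopsC L s R t₀ Z K ∧ ∀ k, k < K → ¬ StopsC L s R t₀ Z k) ↔
      (StopsC L s R t₀ Z K ∧ ¬ StopsC L s R t₀ Z (K - 1)) := by
  constructor
  · rintro ⟨hK, hmin⟩
    have := hK.pos
    exact ⟨hK, hmin (K - 1) (by omega)⟩
  · rintro ⟨hK, hpred⟩
    refine ⟨hK, fun k hk h => hpred (h.of_le hL hdrop hR (by omega))⟩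

/-- **CHAIN-PENDENCY IS A ONE-INDEX TEST**: the line formed at `t₀` is chain-pending at the cutoff `K` iff `t₀ ≤ K`
and it is NOT chain-ready at the last relative index `K − t₀` (an earlier chain-stop would persist to `K − t₀`).
[folklore] -/
theorem pendingAtC_iff_not_stopsC_last {Z : Finset (Pt d)} {K : ℕ} :
    PendingAtC L s R t₀ Z K ↔ t₀ ≤ K ∧ ¬ StopsC L s R t₀ Z (K - t₀) :=
  ⟨fun h => ⟨h.1, h.2 (K - t₀) le_rfl⟩,
    fun h => ⟨h.1, fun _ hk hS => h.2 (hS.of_le hL hdrop hR hk)⟩⟩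

end Monotone

end

end Summit.QuantumFields.BalabanUV.T4Continuum.HistoryReadinessChainRealise
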